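import Summits.HubbardSuperconductivity.HubbardSuperconductivity.Theorems.AnisotropyChordFerroSideLambdaContinuity

/-!
# Route `AnisotropyChord`, crux `FerroSideChord` (stmt-HubbardSuperconductivity-19089), line
# `fm-monotone-anchor`: abstract perturbation lemmas for the FM-end window of `stub_fmEndChord`
# — the overlap bound at the top of a non-negative form, and the overlap deficit of a simple
# gapped ground vector under a bounded perturbation

Finite-dimensional, in `dotProduct` currency (`K` a subspace of `ι → ℂ`, `A = Aᴴ`, `H = Hᴴ`,
`W = Wᴴ` matrices), continuing `FerroSide.energy_ge_of_gap` of
`AnisotropyChordFerroSideLambdaContinuity`: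

* `form_add_smul_expand`, `dot_add_smul_expand`, `two_mul_abs_re_dotProduct_le` (Young),
  `abs_re_form_le_sum_norm_mul` (`|Re⟨x, Yx⟩| ≤ Σ|Yᵢₖ|·‖x‖²`) — bookkeeping;
* **`re_form_ge_mul_sq_overlap_of_isTop`** — if `0 ≤ Re⟨φ, Aφ⟩ ≤ λ‖φ‖²` on `K` and the unit
  vector `ψ₀ ∈ K` attains `λ`, then every unit `ψ ∈ K` with real overlap `c = ⟨ψ₀, ψ⟩` has
  `λc² ≤ Re⟨ψ, Aψ⟩` (maximality kills the cross term);
* **`one_sub_sq_overlap_le_half_of_gap`** — `ψ₀ ∈ K` the simple ground vector of `H` with gap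
  `g` on `K ∩ ψ₀^⊥`, `|Re⟨φ, Wφ⟩| ≤ D‖φ‖²`, `ψ ∈ K` a unit vector with real overlap `c` that is
  variationally below `ψ₀` for `H - sW` (`s ≥ 0`); then `s(4Dg + 8‖Wψ₀‖² + 8) ≤ g²` gives
  `1 - c² ≤ s/2` (the deficit is really `O(s²)`; this linear consequence with constant `1/2` is
  what the chord needs).

Used by `AnisotropyChordFerroSideChordFmEndWindow` (the window `[1-ε_L, 1]` of the FM chord).
T. Kato, *Perturbation Theory for Linear Operators* (1966) I-§6.10, II-§5.1; H. Tasaki, *Physics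
and Mathematics of Quantum Many-Body Systems* (2020) App. A.2.  No definition is introduced.
-/

set_option linter.dupNamespace false

noncomputable section

open Matrix Complex Finset
open scoped ComplexConjugate ComplexOrder
open Literature.MathematicalPhysics.QuantumLattice hiding torusPhase torusNorm

namespace Summit.HubbardSuperconductivity.HubbardSuperconductivity.Theorems.AnisotropyChord.FerroSide

/-! ### Bilinear bookkeeping -/

/-- Expansion of the form `⟨xu + yv, B(xu + yv)⟩`. [folklore] -/
theorem form_add_smul_expand {ι : Type*} [Fintype ι] (B : Matrix ι ι ℂ) (u v : ι → ℂ) (x y : ℂ) :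
    star (x • u + y • v) ⬝ᵥ B *ᵥ (x • u + y • v) =
      star x * x * (star u ⬝ᵥ B *ᵥ u) + star x * y * (star u ⬝ᵥ B *ᵥ v) +
        star y * x * (star v ⬝ᵥ B *ᵥ u) + star y * y * (star v ⬝ᵥ B *ᵥ v) := by
  rw [mulVec_add, mulVec_smul, mulVec_smul, star_add, star_smul, star_smul, add_dotProduct,
    smul_dotProduct, smul_dotProduct, dotProduct_add, dotProduct_add, dotProduct_smul,
    dotProduct_smul, dotProduct_smul, dotProduct_smul]
  simp only [smul_eq_mul]
  ring

/-- Expansion of `⟨xu + yv, xu + yv⟩`. [folklore] -/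
theorem dot_add_smul_expand {ι : Type*} [Fintype ι] [DecidableEq ι] (u v : ι → ℂ) (x y : ℂ) :
    star (x • u + y • v) ⬝ᵥ (x • u + y • v) =
      star x * x * (star u ⬝ᵥ u) + star x * y * (star u ⬝ᵥ v) +
        star y * x * (star v ⬝ᵥ u) + star y * y * (star v ⬝ᵥ v) := by
  have h := form_add_smul_expand (1 : Matrix ι ι ℂ) u v x y
  simpa only [one_mulVec] using h

/-- For Hermitian `W`: `⟨ψ₀, W w⟩ = ⟨W ψ₀, w⟩`. [folklore] -/
theorem star_dotProduct_mulVec_eq_star_mulVec_dotProduct {ι : Type*} [Fintype ι]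
    {W : Matrix ι ι ℂ} (hW : Wᴴ = W) (v w : ι → ℂ) :
    star v ⬝ᵥ W *ᵥ w = star (W *ᵥ v) ⬝ᵥ w := by
  rw [star_mulVec, hW, ← dotProduct_mulVec]

/-- Young's inequality for the real part of a pairing: `2|Re⟨u, w⟩|·a·b ≤ a²‖u‖² + b²‖w‖²`
for all real `a, b` (`0 ≤ ‖au ∓ bw‖²`). [folklore] -/
theorem two_mul_abs_re_dotProduct_le {ι : Type*} [Fintype ι] [DecidableEq ι] (u w : ι → ℂ) (a b : ℝ) :
    2 * |(star u ⬝ᵥ w).re| * a * b ≤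
      a ^ 2 * (star u ⬝ᵥ u).re + b ^ 2 * (star w ⬝ᵥ w).re := by
  have hwu : star w ⬝ᵥ u = star (star u ⬝ᵥ w) := star_dotProduct w u
  have key : ∀ s : ℝ, 0 ≤ a ^ 2 * (star u ⬝ᵥ u).re + 2 * s * a * b * (star u ⬝ᵥ w).re +
      (s * b) ^ 2 * (star w ⬝ᵥ w).re := by
    intro s
    have h0 : 0 ≤ (star ((a : ℂ) • u + ((s * b : ℝ) : ℂ) • w) ⬝ᵥ
        ((a : ℂ) • u + ((s * b : ℝ) : ℂ) • w)).re :=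
      (Complex.nonneg_iff.mp (dotProduct_star_self_nonneg _)).1
    rw [dot_add_smul_expand, hwu] at h0
    simp only [Complex.star_def, Complex.conj_ofReal, ← Complex.ofReal_mul, Complex.add_re,
      Complex.re_ofReal_mul, Complex.conj_re] at h0
    nlinarith [h0]
  rcases le_or_gt 0 ((star u ⬝ᵥ w).re) with hnn | hneg
  · rw [abs_of_nonneg hnn]
    have := key (-1)
    nlinarith [this]
  · rw [abs_of_neg hneg]
    have := key 1
    nlinarith [this]

/-! ### Top eigenvector of a non-negative form: the overlap bound -/

/-- **Overlap bound at the top of a non-negative form.**  `A = Aᴴ` with `0 ≤ Re⟨φ, Aφ⟩ ≤ λ‖φ‖²` on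
a subspace `K`, and `ψ₀ ∈ K` a unit vector ATTAINING the top, `Re⟨ψ₀, Aψ₀⟩ = λ`; then every unit
`ψ ∈ K` with real overlap `c = ⟨ψ₀, ψ⟩` has `λ c² ≤ Re⟨ψ, Aψ⟩` (maximality kills the cross term
`Re⟨ψ₀, A w⟩`, `w = ψ - cψ₀`, and `Re⟨w, Aw⟩ ≥ 0`).  Kato (1966) I-§6.10 (variational
characterisation), finite-dimensional. [folklore] -/
theorem re_form_ge_mul_sq_overlap_of_isTop {ι : Type*} [Fintype ι] [DecidableEq ι]
    {A : Matrix ι ι ℂ} (hA : Aᴴ = A) (K : Submodule ℂ (ι → ℂ)) {lam c : ℝ} {ψ₀ ψ : ι → ℂ}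
    (hψ₀K : ψ₀ ∈ K) (hψ₀1 : star ψ₀ ⬝ᵥ ψ₀ = 1) (hψ₀A : (star ψ₀ ⬝ᵥ A *ᵥ ψ₀).re = lam)
    (htop : ∀ φ ∈ K, (star φ ⬝ᵥ A *ᵥ φ).re ≤ lam * (star φ ⬝ᵥ φ).re)
    (hpos : ∀ φ ∈ K, 0 ≤ (star φ ⬝ᵥ A *ᵥ φ).re)
    (hψK : ψ ∈ K) (hψ1 : star ψ ⬝ᵥ ψ = 1) (hc : star ψ₀ ⬝ᵥ ψ = (c : ℂ)) :
    lam * c ^ 2 ≤ (star ψ ⬝ᵥ A *ᵥ ψ).re := by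
  set w : ι → ℂ := ψ - (c : ℂ) • ψ₀ with hw
  have hwK : w ∈ K := K.sub_mem hψK (K.smul_mem _ hψ₀K)
  have hψψ₀ : star ψ ⬝ᵥ ψ₀ = (c : ℂ) := by
    rw [star_dotProduct, hc, Complex.star_def, Complex.conj_ofReal]
  have h0w : star ψ₀ ⬝ᵥ w = 0 := by
    rw [hw, dotProduct_sub, dotProduct_smul, hψ₀1, hc, smul_eq_mul, mul_one, sub_self]
  have hw0 : star w ⬝ᵥ ψ₀ = 0 := by
    rw [star_dotProduct, h0w, star_zero]
  have hww : star w ⬝ᵥ w = 1 - (c : ℂ) ^ 2 := by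
    rw [hw, star_sub, star_smul, sub_dotProduct, dotProduct_sub, dotProduct_sub, smul_dotProduct,
      smul_dotProduct, dotProduct_smul, dotProduct_smul, hψ1, hψψ₀, hc, hψ₀1]
    simp only [Complex.star_def, Complex.conj_ofReal, smul_eq_mul]
    ring
  have h1re : ((1 : ℂ) - (c : ℂ) ^ 2).re = 1 - c ^ 2 := by
    rw [← Complex.ofReal_pow, ← Complex.ofReal_one, ← Complex.ofReal_sub, Complex.ofReal_re]
  -- the diagonal matrix element `⟨ψ₀, Aψ₀⟩ = λ` is real
  have hr : star ψ₀ ⬝ᵥ A *ᵥ ψ₀ = (lam : ℂ) := by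
    have hsym := EigenvalueContinuation.star_dotProduct_mulVec_comm hA ψ₀ ψ₀
    rw [Complex.star_def] at hsym
    have him : (star ψ₀ ⬝ᵥ A *ᵥ ψ₀).im = 0 := Complex.conj_eq_iff_im.mp hsym.symm
    exact Complex.ext (by rw [hψ₀A, Complex.ofReal_re]) (by rw [him, Complex.ofReal_im])
  -- decomposition `ψ = c ψ₀ + w`
  have hdec : ψ = (c : ℂ) • ψ₀ + (1 : ℂ) • w := by rw [hw, one_smul, add_sub_cancel]
  -- cross matrix elements
  set q : ℂ := star ψ₀ ⬝ᵥ A *ᵥ w with hq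
  have hqw0 : star w ⬝ᵥ A *ᵥ ψ₀ = star q := by
    rw [hq, EigenvalueContinuation.star_dotProduct_mulVec_comm hA w ψ₀]
  set γ : ℝ := (star w ⬝ᵥ A *ᵥ w).re with hγ
  have hγ0 : 0 ≤ γ := hpos w hwK
  have hγtop : γ ≤ lam * (1 - c ^ 2) := by
    have h := htop w hwK
    rw [hww, h1re] at h
    exact h
  -- maximality at the vector `κ ψ₀ + α w` forces `α := Re ⟨ψ₀, A w⟩ = 0`
  set α : ℝ := q.re with hα
  set κ : ℝ := lam * (1 - c ^ 2) - γ + 1 with hκ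
  have hφK : ((κ : ℂ) • ψ₀ + (α : ℂ) • w) ∈ K :=
    K.add_mem (K.smul_mem _ hψ₀K) (K.smul_mem _ hwK)
  have hmax := htop _ hφK
  rw [form_add_smul_expand, dot_add_smul_expand, hr, hqw0, hψ₀1, h0w, hw0, hww] at hmax
  simp only [Complex.star_def, Complex.conj_ofReal, ← Complex.ofReal_mul, Complex.add_re,
    Complex.re_ofReal_mul, Complex.conj_re, Complex.ofReal_re, mul_zero, mul_one, add_zero,
    h1re] at hmax
  have hα0 : α = 0 := by
    have hκ1 : 1 ≤ κ := by rw [hκ]; linarith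
    have key : α ^ 2 * (κ + 1) ≤ 0 := by
      rw [← hγ, ← hα] at hmax
      rw [hκ] at hmax ⊢
      linarith [hmax]
    have hακ : α ^ 2 * 1 ≤ α ^ 2 * κ := mul_le_mul_of_nonneg_left hκ1 (sq_nonneg α)
    have hsq : α ^ 2 = 0 := le_antisymm (by linarith [key, hακ]) (sq_nonneg α)
    exact (pow_eq_zero_iff two_ne_zero).mp hsq
  -- the form at `ψ = c ψ₀ + w`
  have hform : (star ψ ⬝ᵥ A *ᵥ ψ).re = lam * c ^ 2 + 2 * c * α + γ := by
    have h : star ψ ⬝ᵥ A *ᵥ ψ =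
        star ((c : ℂ) • ψ₀ + (1 : ℂ) • w) ⬝ᵥ A *ᵥ ((c : ℂ) • ψ₀ + (1 : ℂ) • w) := by
      rw [← hdec]
    rw [h, form_add_smul_expand, hr, hqw0]
    simp only [Complex.star_def, Complex.conj_ofReal, map_one, one_mul, mul_one, Complex.add_re,
      ← Complex.ofReal_mul, Complex.re_ofReal_mul, Complex.conj_re, Complex.ofReal_re]
    rw [hα, hγ]
    ring
  rw [hform, hα0, mul_zero, add_zero]
  linarith [hγ0]

/-! ### Quadratic overlap deficit at a point where the pencil's ground state is simple -/

/-- **Quadratic overlap deficit.**  `H = Hᴴ` with unit ground vector `ψ₀ ∈ K` (`Hψ₀ = eψ₀`) and a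
gap `g > 0` on `K ∩ ψ₀^⊥`; `W = Wᴴ` with `|Re⟨φ, Wφ⟩| ≤ D‖φ‖²`; `ψ ∈ K` a unit vector with real
overlap `c = ⟨ψ₀, ψ⟩` which is variationally below `ψ₀` for the perturbed form `H - sW`, `s ≥ 0`
(`Re⟨ψ, (H - sW)ψ⟩ ≤ Re⟨ψ₀, (H - sW)ψ₀⟩`).  Then for
`s·(4Dg + 8‖Wψ₀‖² + 8) ≤ g²` the deficit is `1 - c² ≤ s/2` — first-order perturbation theory
of a simple eigenvector with the remainder controlled by the gap (the deficit is `O(s²)`; this is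
the linear-in-`s` consequence with constant `1/2`).  Kato (1966) II-§5.1, finite-dimensional;
Tasaki (2020) App. A.2. [folklore] -/
theorem one_sub_sq_overlap_le_half_of_gap {ι : Type*} [Fintype ι] [DecidableEq ι]
    {H W : Matrix ι ι ℂ} (hH : Hᴴ = H) (hW : Wᴴ = W) (K : Submodule ℂ (ι → ℂ))
    {e g c s D : ℝ} {ψ₀ ψ : ι → ℂ}
    (hψ₀K : ψ₀ ∈ K) (hψ₀1 : star ψ₀ ⬝ᵥ ψ₀ = 1) (hHψ₀ : H *ᵥ ψ₀ = (e : ℂ) • ψ₀) (hg : 0 < g)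
    (hgap : ∀ w ∈ K, star ψ₀ ⬝ᵥ w = 0 → (e + g) * (star w ⬝ᵥ w).re ≤ (star w ⬝ᵥ H *ᵥ w).re)
    (hWD : ∀ φ : ι → ℂ, |(star φ ⬝ᵥ W *ᵥ φ).re| ≤ D * (star φ ⬝ᵥ φ).re)
    (hψK : ψ ∈ K) (hψ1 : star ψ ⬝ᵥ ψ = 1) (hc : star ψ₀ ⬝ᵥ ψ = (c : ℂ)) (hs : 0 ≤ s)
    (hvar : (star ψ ⬝ᵥ H *ᵥ ψ).re - s * (star ψ ⬝ᵥ W *ᵥ ψ).re ≤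
      e - s * (star ψ₀ ⬝ᵥ W *ᵥ ψ₀).re)
    (hsmall : s * (4 * D * g + 8 * (star (W *ᵥ ψ₀) ⬝ᵥ (W *ᵥ ψ₀)).re + 8) ≤ g ^ 2) :
    1 - c ^ 2 ≤ s / 2 := by
  set w : ι → ℂ := ψ - (c : ℂ) • ψ₀ with hw
  have hψψ₀ : star ψ ⬝ᵥ ψ₀ = (c : ℂ) := by
    rw [star_dotProduct, hc, Complex.star_def, Complex.conj_ofReal]
  have hww : star w ⬝ᵥ w = 1 - (c : ℂ) ^ 2 := by
    rw [hw, star_sub, star_smul, sub_dotProduct, dotProduct_sub, dotProduct_sub, smul_dotProduct,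
      smul_dotProduct, dotProduct_smul, dotProduct_smul, hψ1, hψψ₀, hc, hψ₀1]
    simp only [Complex.star_def, Complex.conj_ofReal, smul_eq_mul]
    ring
  have h1re : ((1 : ℂ) - (c : ℂ) ^ 2).re = 1 - c ^ 2 := by
    rw [← Complex.ofReal_pow, ← Complex.ofReal_one, ← Complex.ofReal_sub, Complex.ofReal_re]
  have hdec : ψ = (c : ℂ) • ψ₀ + (1 : ℂ) • w := by rw [hw, one_smul, add_sub_cancel]
  -- the gap estimate from below and the variational estimate from above: `g x ≤ s (b - b₀)`
  have hlow := energy_ge_of_gap hH K hψ₀K hψ₀1 hHψ₀ hgap hψK hψ1 hc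
  obtain ⟨x, hx⟩ : ∃ x : ℝ, x = 1 - c ^ 2 := ⟨_, rfl⟩
  obtain ⟨σ2, hσ2⟩ : ∃ σ2 : ℝ, σ2 = (star (W *ᵥ ψ₀) ⬝ᵥ (W *ᵥ ψ₀)).re := ⟨_, rfl⟩
  rw [← hx]
  rw [← hx] at hlow
  rw [← hσ2] at hsmall
  have hx0 : 0 ≤ x := by
    have h0 : 0 ≤ (star w ⬝ᵥ w).re := (Complex.nonneg_iff.mp (dotProduct_star_self_nonneg w)).1
    rw [hww, h1re, ← hx] at h0
    exact h0
  have hσ0 : 0 ≤ σ2 := by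
    rw [hσ2]
    exact (Complex.nonneg_iff.mp (dotProduct_star_self_nonneg _)).1
  have hD0 : 0 ≤ D := by
    have h := hWD ψ₀
    rw [hψ₀1, Complex.one_re, mul_one] at h
    exact le_trans (abs_nonneg _) h
  have hstar : g * x ≤ s * ((star ψ ⬝ᵥ W *ᵥ ψ).re - (star ψ₀ ⬝ᵥ W *ᵥ ψ₀).re) := by
    linarith [hlow, hvar]
  -- expansion of `b = Re⟨ψ, Wψ⟩` along `ψ = c ψ₀ + w`
  obtain ⟨q, hq⟩ : ∃ q : ℂ, q = star ψ₀ ⬝ᵥ W *ᵥ w := ⟨_, rfl⟩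
  have hqw0 : star w ⬝ᵥ W *ᵥ ψ₀ = star q := by
    rw [hq, EigenvalueContinuation.star_dotProduct_mulVec_comm hW w ψ₀]
  have hbexp : (star ψ ⬝ᵥ W *ᵥ ψ).re = c ^ 2 * (star ψ₀ ⬝ᵥ W *ᵥ ψ₀).re + 2 * c * q.re +
      (star w ⬝ᵥ W *ᵥ w).re := by
    have h : star ψ ⬝ᵥ W *ᵥ ψ =
        star ((c : ℂ) • ψ₀ + (1 : ℂ) • w) ⬝ᵥ W *ᵥ ((c : ℂ) • ψ₀ + (1 : ℂ) • w) := by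
      rw [← hdec]
    rw [h, form_add_smul_expand, hqw0, ← hq]
    simp only [Complex.star_def, Complex.conj_ofReal, map_one, one_mul, mul_one, Complex.add_re,
      ← Complex.ofReal_mul, Complex.re_ofReal_mul, Complex.conj_re]
    ring
  -- the three bounds
  have hwWw : |(star w ⬝ᵥ W *ᵥ w).re| ≤ D * x := by
    have h := hWD w
    rw [hww, h1re, ← hx] at h
    exact h
  have hb0D : |(star ψ₀ ⬝ᵥ W *ᵥ ψ₀).re| ≤ D := by
    have h := hWD ψ₀
    rw [hψ₀1, Complex.one_re, mul_one] at h
    exact h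
  have hc1 : |c| ≤ 1 := by
    rw [← sq_le_one_iff_abs_le_one]
    linarith [hx0]
  have hcq : 2 * c * q.re ≤ 2 * |q.re| := by
    have h : c * q.re ≤ |q.re| := by
      calc c * q.re ≤ |c * q.re| := le_abs_self _
        _ = |c| * |q.re| := abs_mul _ _
        _ ≤ 1 * |q.re| := mul_le_mul_of_nonneg_right hc1 (abs_nonneg _)
        _ = |q.re| := one_mul _
    linarith
  have hbb : (star ψ ⬝ᵥ W *ᵥ ψ).re - (star ψ₀ ⬝ᵥ W *ᵥ ψ₀).re ≤ 2 * D * x + 2 * |q.re| := by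
    have e1 : (c ^ 2 - 1) * (star ψ₀ ⬝ᵥ W *ᵥ ψ₀).re ≤ D * x := by
      have h2 : (c ^ 2 - 1) * (star ψ₀ ⬝ᵥ W *ᵥ ψ₀).re = -(x * (star ψ₀ ⬝ᵥ W *ᵥ ψ₀).re) := by
        rw [hx]; ring
      rw [h2]
      have h3 : -(x * (star ψ₀ ⬝ᵥ W *ᵥ ψ₀).re) ≤ x * |(star ψ₀ ⬝ᵥ W *ᵥ ψ₀).re| := by
        have h4 := mul_le_mul_of_nonneg_left (neg_abs_le (star ψ₀ ⬝ᵥ W *ᵥ ψ₀).re) hx0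
        linarith
      have h5 := mul_le_mul_of_nonneg_left hb0D hx0
      linarith
    have e2 := (abs_le.mp hwWw).2
    rw [hbexp]
    linarith
  -- `q = ⟨Wψ₀, w⟩`; Young with weights `g` and `T = 4σ² + 4`
  have hqu : q = star (W *ᵥ ψ₀) ⬝ᵥ w := by
    rw [hq, star_dotProduct_mulVec_eq_star_mulVec_dotProduct hW ψ₀ w]
  obtain ⟨T, hT⟩ : ∃ T : ℝ, T = 4 * σ2 + 4 := ⟨_, rfl⟩
  have hT0 : 0 < T := by rw [hT]; positivity
  have hY : 2 * |q.re| * g * T ≤ g ^ 2 * σ2 + T ^ 2 * x := by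
    have h := two_mul_abs_re_dotProduct_le (W *ᵥ ψ₀) w g T
    rw [← hqu, hww, h1re, ← hx, ← hσ2] at h
    exact h
  -- combine
  have h1 : g * x * (g * T) ≤ s * (2 * D * x + 2 * |q.re|) * (g * T) :=
    mul_le_mul_of_nonneg_right (le_trans hstar (mul_le_mul_of_nonneg_left hbb hs))
      (by positivity)
  have h2 : s * (2 * |q.re| * g * T) ≤ s * (g ^ 2 * σ2 + T ^ 2 * x) :=
    mul_le_mul_of_nonneg_left hY hs
  have h3 : g ^ 2 * (T * x) ≤ s * (2 * D * g * T * x) + s * (g ^ 2 * σ2) + s * (T ^ 2 * x) := by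
    linarith [h1, h2]
  have hsmall' : s * (4 * D * g + 2 * T) ≤ g ^ 2 := by rw [hT]; linarith [hsmall]
  have h4 : s * (4 * D * g + 2 * T) * (T * x) ≤ g ^ 2 * (T * x) :=
    mul_le_mul_of_nonneg_right hsmall' (by positivity)
  have h5 : g ^ 2 * (T * x) ≤ g ^ 2 * (2 * s * σ2) := by linarith [h3, h4]
  have h6 : T * x ≤ 2 * s * σ2 := le_of_mul_le_mul_left h5 (pow_pos hg 2)
  have h7 : T * x ≤ T * (s / 2) := by
    rw [hT] at h6 ⊢
    linarith [h6, hs]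
  exact le_of_mul_le_mul_left h7 hT0

/-- `|Re⟨x, Y x⟩| ≤ (Σᵢₖ |Yᵢₖ|) · Re⟨x, x⟩` for every vector `x` (each `|xᵢ||xₖ| ≤ ‖x‖²`).
[folklore] -/
theorem abs_re_form_le_sum_norm_mul {ι : Type*} [Fintype ι] (Y : Matrix ι ι ℂ) (x : ι → ℂ) :
    |(star x ⬝ᵥ Y *ᵥ x).re| ≤ (∑ i, ∑ k, ‖Y i k‖) * (star x ⬝ᵥ x).re := by
  have hxx : (star x ⬝ᵥ x).re = ∑ i, ‖x i‖ ^ 2 := by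
    simp only [dotProduct, Pi.star_apply, Complex.re_sum]
    refine Finset.sum_congr rfl fun i _ => ?_
    rw [Complex.star_def, ← Complex.normSq_eq_conj_mul_self, Complex.normSq_eq_norm_sq]
    norm_cast
  have hxi : ∀ i, ‖x i‖ ^ 2 ≤ (star x ⬝ᵥ x).re := fun i => by
    rw [hxx]
    exact Finset.single_le_sum (f := fun j => ‖x j‖ ^ 2) (fun _ _ => by positivity)
      (Finset.mem_univ i)
  have hprod : ∀ i k, ‖x i‖ * ‖x k‖ ≤ (star x ⬝ᵥ x).re := fun i k => by
    nlinarith [hxi i, hxi k, norm_nonneg (x i), norm_nonneg (x k), sq_nonneg (‖x i‖ - ‖x k‖)]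
  calc |(star x ⬝ᵥ Y *ᵥ x).re| ≤ ‖star x ⬝ᵥ Y *ᵥ x‖ := Complex.abs_re_le_norm _
    _ = ‖∑ i, star (x i) * ∑ k, Y i k * x k‖ := by
        simp only [dotProduct, mulVec, Pi.star_apply]
    _ ≤ ∑ i, ‖star (x i) * ∑ k, Y i k * x k‖ := norm_sum_le _ _
    _ ≤ ∑ i, ∑ k, ‖Y i k‖ * (‖x i‖ * ‖x k‖) := by
        refine Finset.sum_le_sum fun i _ => ?_
        rw [norm_mul, norm_star]
        calc ‖x i‖ * ‖∑ k, Y i k * x k‖ ≤ ‖x i‖ * ∑ k, ‖Y i k * x k‖ :=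
              mul_le_mul_of_nonneg_left (norm_sum_le _ _) (norm_nonneg _)
          _ = ∑ k, ‖Y i k‖ * (‖x i‖ * ‖x k‖) := by
              rw [Finset.mul_sum]
              refine Finset.sum_congr rfl fun k _ => ?_
              rw [norm_mul]; ring
    _ ≤ ∑ i, ∑ k, ‖Y i k‖ * (star x ⬝ᵥ x).re :=
        Finset.sum_le_sum fun i _ => Finset.sum_le_sum fun k _ =>
          mul_le_mul_of_nonneg_left (hprod i k) (norm_nonneg _)
    _ = (∑ i, ∑ k, ‖Y i k‖) * (star x ⬝ᵥ x).re := by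
        rw [Finset.sum_mul]; refine Finset.sum_congr rfl fun i _ => ?_; rw [Finset.sum_mul]

end Summit.HubbardSuperconductivity.HubbardSuperconductivity.Theorems.AnisotropyChord.FerroSide

end
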